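import Summits.NavierStokesRegularity.NavierStokesRegularity.Theorems.QuietScarPocketDoorLPocketDefs

/-!
# QuietScarPocketDoorLPlanarRigidity — §B «L-pocket schema» (texts `QuietScarPocketDoorLPocketDefs`, nsreg-p1 g25 Sketch31D
# 8bb56c0a84466268), plate (P5): `planarRigidity_holds : PlanarRigidity`

Seat nsreg-C26-p1 g4 (S-door lane, LEAD ns-s30-p1 g2; DIRECTOR-NS #209 (2)); `--supports stmt-NavierStokesRegularity-0056 --as helper`.

Instance `L = planarCLM e` of the schema («PLANAR pocket»: `∂ₑu` small on the pocket).  The static rigidity input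
`PlanarRigidity := ∀ e, ‖e‖ = 1 → StaticLRigidity (planarCLM e)`: a real-analytic field `V` on `ℝ³∖{0}` with Type-I decay
`‖V(y)‖ ≤ C/‖y‖` and `∂ₑV ≡ 0` off the apex is irrotational off the apex — indeed `V ≡ 0` off the apex
(`eq_zero_offApex_of_fderiv_apply_eq_zero`): from every `y ≠ 0` one of the two closed half-lines `y ± t e`, `t ≥ 0`, misses
the apex; along it `t ↦ V(y + t e)` has zero derivative, hence is constant (`constant_of_has_deriv_right_zero`), and the decay
sends it to `0` as `t → ∞`; so `V(y) = 0`, `∇V ≡ 0` on the open punctured space, `curl V ≡ 0` there.  Only the decay of `V` and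
the directional constraint are used (not the gradient decay, not `div V = 0`).

WHAT THIS IS NOT: a static calculus lemma for a corollary schema about HYPOTHETICAL Type-I profiles; item 0056 `NoTypeII` and
Navier–Stokes regularity are NOT proved. [folklore]
-/

noncomputable section

set_option linter.dupNamespace false

namespace Summit.NavierStokesRegularity.NavierStokesRegularity.Theorems.QuietScarPocketDoor

open Set Function Filter Topology Metric
open scoped RealInnerProductSpace InnerProductSpace
open Literature.Analysis Literature.Analysis.FluidPDE

/-- **A field with Type-I decay and one vanishing directional derivative off the apex vanishes off the apex.**  If `V` is
differentiable at every `y ≠ 0` with `‖V(y)‖ ≤ C/‖y‖` there, `e ≠ 0`, and `∇V(y) e = 0` for all `y ≠ 0`, then `V(y) = 0` for all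
`y ≠ 0` (constancy along the half-line from `y` in the direction `±e` that misses the apex, then decay). [folklore] -/
theorem eq_zero_offApex_of_fderiv_apply_eq_zero {V : EuclideanSpace ℝ (Fin 3) → EuclideanSpace ℝ (Fin 3)}
    {e : EuclideanSpace ℝ (Fin 3)} (he : e ≠ 0)
    (hdiff : ∀ y : EuclideanSpace ℝ (Fin 3), y ≠ 0 → DifferentiableAt ℝ V y)
    (hV : ∃ C : ℝ, ∀ y : EuclideanSpace ℝ (Fin 3), y ≠ 0 → ‖V y‖ ≤ C / ‖y‖)
    (hL : ∀ y : EuclideanSpace ℝ (Fin 3), y ≠ 0 → fderiv ℝ V y e = 0)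
    {y : EuclideanSpace ℝ (Fin 3)} (hy : y ≠ 0) : V y = 0 := by
  obtain ⟨C, hC⟩ := hV
  -- one of the two closed half-lines from `y` along `±e` misses the apex
  obtain ⟨e', he'e, hray⟩ : ∃ e' : EuclideanSpace ℝ (Fin 3), (e' = e ∨ e' = -e) ∧
      ∀ t : ℝ, 0 ≤ t → y + t • e' ≠ 0 := by
    by_contra h
    push Not at h
    obtain ⟨t₁, ht₁, h₁⟩ := h e (Or.inl rfl)
    obtain ⟨t₂, ht₂, h₂⟩ := h (-e) (Or.inr rfl)
    have hsum : (t₁ + t₂) • e = 0 := by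
      have : y + t₁ • e - (y + t₂ • -e) = 0 := by rw [h₁, h₂, sub_zero]
      rw [← this, smul_neg, add_smul]; abel
    rcases smul_eq_zero.1 hsum with h0 | h0
    · have ht₁0 : t₁ = 0 := by linarith
      rw [ht₁0, zero_smul, add_zero] at h₁
      exact hy h₁
    · exact he h0
  have he'0 : e' ≠ 0 := by rcases he'e with rfl | rfl <;> simp [he]
  have hL' : ∀ z : EuclideanSpace ℝ (Fin 3), z ≠ 0 → fderiv ℝ V z e' = 0 := by
    intro z hz; rcases he'e with rfl | rfl
    · exact hL z hz
    · rw [map_neg, hL z hz, neg_zero]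
  -- `t ↦ V(y + t e')` is constant on `[0, ∞)`
  set g : ℝ → EuclideanSpace ℝ (Fin 3) := fun t => V (y + t • e') with hg
  have hgd : ∀ t : ℝ, 0 ≤ t → HasDerivAt g 0 t := by
    intro t ht
    have hγ : HasDerivAt (fun s : ℝ => y + s • e') e' t := by
      simpa using ((hasDerivAt_id t).smul_const e').const_add y
    have hVd := (hdiff _ (hray t ht)).hasFDerivAt
    have := hVd.comp_hasDerivAt t hγ
    rwa [hL' _ (hray t ht)] at this
  have hconst : ∀ t : ℝ, 0 ≤ t → g t = g 0 := by
    intro t ht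
    have hc : ContinuousOn g (Icc 0 t) := fun s hs => (hgd s hs.1).continuousAt.continuousWithinAt
    exact constant_of_has_deriv_right_zero hc (fun s hs => (hgd s hs.1).hasDerivWithinAt) t
      ⟨ht, le_rfl⟩
  -- decay along the half-line
  have hnorm : ∀ t : ℝ, ‖y‖ < t * ‖e'‖ → ‖V y‖ ≤ C / (t * ‖e'‖ - ‖y‖) := by
    intro t ht
    have he'n : 0 < ‖e'‖ := norm_pos_iff.2 he'0
    have ht0 : 0 ≤ t := by
      by_contra h'
      have : t * ‖e'‖ < 0 := mul_neg_of_neg_of_pos (lt_of_not_ge h') he'n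
      linarith [norm_nonneg y]
    have hyt : y + t • e' ≠ 0 := hray t ht0
    have hlow : t * ‖e'‖ - ‖y‖ ≤ ‖y + t • e'‖ := by
      have h1 : ‖t • e'‖ ≤ ‖y + t • e'‖ + ‖y‖ := by
        have := norm_sub_le (y + t • e') y
        rwa [add_sub_cancel_left] at this
      rw [norm_smul, Real.norm_of_nonneg ht0] at h1
      linarith
    have hpos : 0 < t * ‖e'‖ - ‖y‖ := by linarith
    have key := hC _ hyt
    have hgy : V y = V (y + t • e') := by
      have := hconst t ht0
      simp only [hg, zero_smul, add_zero] at this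
      exact this.symm
    rw [hgy]
    refine key.trans ?_
    by_cases hC0 : 0 ≤ C
    · exact div_le_div_of_nonneg_left hC0 hpos hlow
    · exfalso
      have : C / ‖y + t • e'‖ < 0 := div_neg_of_neg_of_pos (lt_of_not_ge hC0) (norm_pos_iff.2 hyt)
      linarith [norm_nonneg (V (y + t • e'))]
  have he'n : 0 < ‖e'‖ := norm_pos_iff.2 he'0
  have hlim : Tendsto (fun t : ℝ => C / (t * ‖e'‖ - ‖y‖)) atTop (𝓝 0) :=
    tendsto_const_nhds.div_atTop
      (tendsto_atTop_add_const_right _ _ (tendsto_id.atTop_mul_const he'n))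
  have hev : ∀ᶠ t : ℝ in atTop, ‖V y‖ ≤ C / (t * ‖e'‖ - ‖y‖) := by
    filter_upwards [eventually_gt_atTop (‖y‖ / ‖e'‖)] with t ht
    exact hnorm t (by rwa [div_lt_iff₀ he'n] at ht)
  exact norm_le_zero_iff.1 (ge_of_tendsto hlim hev)

/-- **(P5) PLANAR RIGIDITY** (`PlanarRigidity := ∀ e, ‖e‖ = 1 → StaticLRigidity (planarCLM e)`): a real-analytic field on
`ℝ³∖{0}` with Type-I decay whose directional derivative `∂ₑV` vanishes off the apex vanishes off the apex, hence is irrotational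
there (`∇V(y) = 0` on the open punctured space). [folklore] -/
theorem planarRigidity_holds : PlanarRigidity := by
  intro e he V hA hV _ _ hL y hy
  have he0 : e ≠ 0 := by
    intro h; rw [h, norm_zero] at he; exact zero_ne_one he
  have hdiff : ∀ z : EuclideanSpace ℝ (Fin 3), z ≠ 0 → DifferentiableAt ℝ V z :=
    fun z hz => (hA z hz).differentiableAt
  have hL' : ∀ z : EuclideanSpace ℝ (Fin 3), z ≠ 0 → fderiv ℝ V z e = 0 := fun z hz => by
    have h := hL z hz
    rwa [planarCLM_apply] at h
  have hzero : ∀ z : EuclideanSpace ℝ (Fin 3), z ≠ 0 → V z = 0 :=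
    fun z hz => eq_zero_offApex_of_fderiv_apply_eq_zero he0 hdiff hV hL' hz
  -- `V = 0` near `y`, so `∇V(y) = 0`
  have hev : V =ᶠ[𝓝 y] fun _ => 0 := by
    filter_upwards [isOpen_compl_singleton.mem_nhds (show y ∈ ({0}ᶜ : Set (EuclideanSpace ℝ (Fin 3))) from hy)]
      with z hz
    exact hzero z hz
  rw [curl_eq_curlCLM, hev.fderiv_eq, fderiv_const_apply, map_zero]

end Summit.NavierStokesRegularity.NavierStokesRegularity.Theorems.QuietScarPocketDoor

end
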